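/-
Copyright: the b2b-balaban T⁴-continuum CRUX team, row NE7b OWNER lineage `t4-ne7b-p1` (gen 142). Project licence.
-/
import Summits.QuantumFields.BalabanUV.T4Continuum.Spine.NE7b.SupFourthOrderMonomials

/-!
# THE COMPOSITE TILTED INTEGRALS OF THE ORDER-FOUR FORM, SPLIT INTO CANONICAL MONOMIALS (SCOPING (d13)(2): the cumulant FORM of `∂⁴W`,
# seventh file).  (516)'s raw fourth derivative of `W` along `m` is a polynomial in the composite integrals `G_v′m = ∫e(B_mv − A_vA_m)`,
# `H_vw = ∫e(B_vw − A_vA_w)`, `H_vw′m = ∫e(C_mvw − A_vB_mw − A_wB_mv − (B_vw − A_vA_w)A_m)`, `Φ_hkl = ∫e·p₃`, `Φ_hkl′m = ∫e·Ψ_hklm`; the CENTRED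
# (cumulant) display of the next file has the centred triples `∫e(B − b)(A − a)(A′ − a′)` (two placements of the `m`-entry), the centred pairs
# and the centred quadruple of the fourth cumulant.  Here EVERY one of them is split, by linearity of the Bochner integral against
# `e^{−U(ω+ψ)}dN(0,Γ)` (integrability of each monomial from (518)), into the canonical monomial integrals `∫e·M` with ONE fixed factor order per
# monomial (the `m`-carrying factor first, then gradient before Hessian before third-derivative entries) — so that the raw and the centred sides
# of the next file meet on literally the same 51 integrals and (517)'s letters identity applies (row NE7b, node U5c; (518) BY NAME; [folklore])

Cell `pub-balaban`, sub-cell `t4`, spine estimate NE7b (`T4WeightBudget.RelWeightBound`; the cell's OWN estimate — NOT PRINTED in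
[Bałaban 1983–89], NOT PROVED).  Crux-route work under `Spine/NE7b/` by the row OWNER (`t4-ne7b-p1` gen 142, file (519)) under FREEZE
(0)'s crux-prover clause; NOTHING of Bałaban's is named as a Lean object, valued or asserted; no `T4Continuum/Support` leaf typed; no
`def`, no notation; zero `sorry`.  Imports (BY NAME): the OWNER's (518) `…SupFourthOrderMonomials` (the thirteen shapes and `integrable_e`; through it (400)
`SupBlockUpperLetter.integrable_weighted_blockDeriv_apply` for the single gradient entry).

WHAT IS PROVED ([folklore]; general `Γ ⪰ 0` with the regulator; every centring constant an arbitrary real):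
* `split_two`, `split_dG`, `split_P3`, `split_dH`, `split_PSI` (the raw side); `split_tripleB`, `split_tripleA`, `split_pair`, `split_quad` (the
  centred side); toy.

HONEST (what this is NOT).  Linearity bookkeeping (pointwise `ring` under the integral, then `integral_add`∕`integral_sub` along the sum); the
centred display of `∂⁴W` and the assembly of the order-4 kernel letter are the next files.  Scalar skeleton ((A3), NC-NE7b-α UNRULED); nothing of
Bałaban's asserted.  BY-NAME EFFECT ON THE WALL: NONE.  NE7b NOT PRINTED ∕ NOT PROVED; spine PROVED 0∕9; rung (B)+1 — the programme's measures
remain FINITE-torus statements; NOT the mass gap, NOT Clay.  HONEST DEPENDENCY: continuum YM on T⁴ ⇐ BetaPertH ∧ nine spine estimates (0∕9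
proved); BetaPertH ⇐ (D1) ∧ (D4) ∧ CAP+tail; G-an2-4 gates asym, D1 and NE2∕3∕4.
-/

set_option autoImplicit false
set_option maxSynthPendingDepth 3

noncomputable section

namespace Summit.QuantumFields.BalabanUV.T4Continuum.NE7b.SupFourthOrderSplitting

open MeasureTheory ProbabilityTheory Finset Real Metric Filter
open scoped BigOperators Topology
open SupBlockUpperLetter (integrable_weighted_blockDeriv_apply)
open SupFourthOrderMonomials (integrable_e integrable_eAA integrable_eAAA integrable_eAAAA integrable_eB integrable_eAB integrable_eBA
  integrable_eAAB integrable_eBAA integrable_eBB integrable_eC integrable_eAC integrable_eCA integrable_eD)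

variable {ι : Type} [Fintype ι] [DecidableEq ι]

variable {Γ : Matrix ι ι ℝ} {γop : ℝ} {U : EuclideanSpace ℝ ι → ℝ} {U' : EuclideanSpace ℝ ι → EuclideanSpace ℝ ι →L[ℝ] ℝ}
  {U'' : EuclideanSpace ℝ ι → EuclideanSpace ℝ ι →L[ℝ] EuclideanSpace ℝ ι →L[ℝ] ℝ}
  {U₃ : EuclideanSpace ℝ ι → EuclideanSpace ℝ ι →L[ℝ] EuclideanSpace ℝ ι →L[ℝ] EuclideanSpace ℝ ι →L[ℝ] ℝ}
  {U₄ : EuclideanSpace ℝ ι → EuclideanSpace ℝ ι →L[ℝ] EuclideanSpace ℝ ι →L[ℝ] EuclideanSpace ℝ ι →L[ℝ] EuclideanSpace ℝ ι →L[ℝ] ℝ}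
  {κ₀ κ₁ κ₂ κ₃ κ₄ a τ δ θ : ℝ}

/-! ## §1. The raw side -/


/-- `∫e(B_vw − A_vA_w) = ∫eB_vw − ∫eA_vA_w` ((516)'s `H_{vw}`). [folklore] -/
theorem split_two (hΓ : Γ.PosSemidef) (hΓop : (γop • (1 : Matrix ι ι ℝ) - Γ).PosSemidef) (Y : Finset ι)
    (hUd : ∀ φ : EuclideanSpace ℝ ι, HasFDerivAt U (U' φ) φ) (hU'c : Continuous U') (hU''c : Continuous U'') (hU''b : ∀ φ : EuclideanSpace ℝ ι, ‖U''
        φ‖ ≤ κ₂)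
    (hκ₀ : 0 ≤ κ₀) (hκ₁ : 0 ≤ κ₁) (ha : 0 ≤ a) (hτ : 0 < τ) (hδ : 0 < δ) (hθ1 : θ < 1) (hκθ : (2 * κ₀ * (1 + τ) + 4 * δ) * γop ≤ θ)
    (hstab : ∀ φ : EuclideanSpace ℝ ι, -(κ₀ * ∑ x ∈ Y, φ x ^ 2) ≤ U φ) (hU'b : ∀ φ : EuclideanSpace ℝ ι, ‖U' φ‖ ≤ κ₁ * (a + ∑ x ∈ Y, φ x ^ 2)) (ψ :
        EuclideanSpace ℝ ι) (v w : EuclideanSpace ℝ ι) :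
    (∫ ω : EuclideanSpace ℝ ι, exp (-U (ω + ψ)) * (U'' (ω + ψ) v w - U' (ω + ψ) v * U' (ω + ψ) w) ∂(multivariateGaussian 0 Γ)) =
      (∫ ω : EuclideanSpace ℝ ι, exp (-U (ω + ψ)) * U'' (ω + ψ) v w ∂(multivariateGaussian 0 Γ)) - (∫ ω : EuclideanSpace ℝ ι, exp (-U (ω + ψ)) * (U'
          (ω + ψ) v * U' (ω + ψ) w) ∂(multivariateGaussian 0 Γ)) := by
  have e1 : ∀ ω : EuclideanSpace ℝ ι, exp (-U (ω + ψ)) * (U'' (ω + ψ) v w - U' (ω + ψ) v * U' (ω + ψ) w) =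
      (exp (-U (ω + ψ)) * U'' (ω + ψ) v w) - (exp (-U (ω + ψ)) * (U' (ω + ψ) v * U' (ω + ψ) w)) := fun ω => by ring
  simp_rw [e1]
  have i1 := (integrable_eB hΓ hΓop Y hUd hU''c hU''b hκ₀ hκ₁ ha hτ hδ hθ1 hκθ hstab hU'b ψ v w)
  have i2 := (integrable_eAA hΓ hΓop Y hUd hU'c hκ₀ hκ₁ ha hτ hδ hθ1 hκθ hstab hU'b ψ v w)
  rw [integral_sub i1 i2]

/-- `∫e(B_mv − A_vA_m) = ∫eB_mv − ∫eA_mA_v` ((516)'s `G_v′m`; the `m`-factor first). [folklore] -/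
theorem split_dG (hΓ : Γ.PosSemidef) (hΓop : (γop • (1 : Matrix ι ι ℝ) - Γ).PosSemidef) (Y : Finset ι)
    (hUd : ∀ φ : EuclideanSpace ℝ ι, HasFDerivAt U (U' φ) φ) (hU'c : Continuous U') (hU''c : Continuous U'') (hU''b : ∀ φ : EuclideanSpace ℝ ι, ‖U''
        φ‖ ≤ κ₂)
    (hκ₀ : 0 ≤ κ₀) (hκ₁ : 0 ≤ κ₁) (ha : 0 ≤ a) (hτ : 0 < τ) (hδ : 0 < δ) (hθ1 : θ < 1) (hκθ : (2 * κ₀ * (1 + τ) + 4 * δ) * γop ≤ θ)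
    (hstab : ∀ φ : EuclideanSpace ℝ ι, -(κ₀ * ∑ x ∈ Y, φ x ^ 2) ≤ U φ) (hU'b : ∀ φ : EuclideanSpace ℝ ι, ‖U' φ‖ ≤ κ₁ * (a + ∑ x ∈ Y, φ x ^ 2)) (ψ :
        EuclideanSpace ℝ ι) (m v : EuclideanSpace ℝ ι) :
    (∫ ω : EuclideanSpace ℝ ι, exp (-U (ω + ψ)) * (U'' (ω + ψ) m v - U' (ω + ψ) v * U' (ω + ψ) m) ∂(multivariateGaussian 0 Γ)) =
      (∫ ω : EuclideanSpace ℝ ι, exp (-U (ω + ψ)) * U'' (ω + ψ) m v ∂(multivariateGaussian 0 Γ)) - (∫ ω : EuclideanSpace ℝ ι, exp (-U (ω + ψ)) * (U'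
          (ω + ψ) m * U' (ω + ψ) v) ∂(multivariateGaussian 0 Γ)) := by
  have e1 : ∀ ω : EuclideanSpace ℝ ι, exp (-U (ω + ψ)) * (U'' (ω + ψ) m v - U' (ω + ψ) v * U' (ω + ψ) m) =
      (exp (-U (ω + ψ)) * U'' (ω + ψ) m v) - (exp (-U (ω + ψ)) * (U' (ω + ψ) m * U' (ω + ψ) v)) := fun ω => by ring
  simp_rw [e1]
  have i1 := (integrable_eB hΓ hΓop Y hUd hU''c hU''b hκ₀ hκ₁ ha hτ hδ hθ1 hκθ hstab hU'b ψ m v)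
  have i2 := (integrable_eAA hΓ hΓop Y hUd hU'c hκ₀ hκ₁ ha hτ hδ hθ1 hκθ hstab hU'b ψ m v)
  rw [integral_sub i1 i2]

/-- `∫e·p₃` split, `p₃ = C_hkl − A_kB_hl − B_hkA_l − A_hB_kl + A_hA_kA_l` ((516)'s `Φ_{hkl}`; canonical factor order). [folklore] -/
theorem split_P3 (hΓ : Γ.PosSemidef) (hΓop : (γop • (1 : Matrix ι ι ℝ) - Γ).PosSemidef) (Y : Finset ι)
    (hUd : ∀ φ : EuclideanSpace ℝ ι, HasFDerivAt U (U' φ) φ) (hU'c : Continuous U') (hU''c : Continuous U'') (hU₃c : Continuous U₃) (hU''b : ∀ φ :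
        EuclideanSpace ℝ ι, ‖U'' φ‖ ≤ κ₂) (hU₃b : ∀ φ : EuclideanSpace ℝ ι, ‖U₃ φ‖ ≤ κ₃)
    (hκ₀ : 0 ≤ κ₀) (hκ₁ : 0 ≤ κ₁) (ha : 0 ≤ a) (hτ : 0 < τ) (hδ : 0 < δ) (hθ1 : θ < 1) (hκθ : (2 * κ₀ * (1 + τ) + 4 * δ) * γop ≤ θ)
    (hstab : ∀ φ : EuclideanSpace ℝ ι, -(κ₀ * ∑ x ∈ Y, φ x ^ 2) ≤ U φ) (hU'b : ∀ φ : EuclideanSpace ℝ ι, ‖U' φ‖ ≤ κ₁ * (a + ∑ x ∈ Y, φ x ^ 2)) (ψ :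
        EuclideanSpace ℝ ι) (h k l : EuclideanSpace ℝ ι) :
    (∫ ω : EuclideanSpace ℝ ι, exp (-U (ω + ψ)) * (U₃ (ω + ψ) h k l - U' (ω + ψ) k * U'' (ω + ψ) h l - U'' (ω + ψ) h k * U' (ω + ψ) l - U' (ω + ψ) h
        * U'' (ω + ψ) k l + U' (ω + ψ) h * U' (ω + ψ) k * U' (ω + ψ) l) ∂(multivariateGaussian 0 Γ)) =
      (∫ ω : EuclideanSpace ℝ ι, exp (-U (ω + ψ)) * U₃ (ω + ψ) h k l ∂(multivariateGaussian 0 Γ)) - (∫ ω : EuclideanSpace ℝ ι, exp (-U (ω + ψ)) * (U'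
          (ω + ψ) k * U'' (ω + ψ) h l) ∂(multivariateGaussian 0 Γ)) - (∫ ω : EuclideanSpace ℝ ι, exp (-U (ω + ψ)) * (U' (ω + ψ) l * U'' (ω + ψ) h k)
          ∂(multivariateGaussian 0 Γ)) - (∫ ω : EuclideanSpace ℝ ι, exp (-U (ω + ψ)) * (U' (ω + ψ) h * U'' (ω + ψ) k l) ∂(multivariateGaussian 0 Γ))
          + (∫ ω : EuclideanSpace ℝ ι, exp (-U (ω + ψ)) * (U' (ω + ψ) h * U' (ω + ψ) k * U' (ω + ψ) l) ∂(multivariateGaussian 0 Γ)) := by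
  have e1 : ∀ ω : EuclideanSpace ℝ ι, exp (-U (ω + ψ)) * (U₃ (ω + ψ) h k l - U' (ω + ψ) k * U'' (ω + ψ) h l - U'' (ω + ψ) h k * U' (ω + ψ) l - U' (ω
      + ψ) h * U'' (ω + ψ) k l + U' (ω + ψ) h * U' (ω + ψ) k * U' (ω + ψ) l) =
      (exp (-U (ω + ψ)) * U₃ (ω + ψ) h k l) - (exp (-U (ω + ψ)) * (U' (ω + ψ) k * U'' (ω + ψ) h l)) - (exp (-U (ω + ψ)) * (U' (ω + ψ) l * U'' (ω + ψ)
          h k)) - (exp (-U (ω + ψ)) * (U' (ω + ψ) h * U'' (ω + ψ) k l)) + (exp (-U (ω + ψ)) * (U' (ω + ψ) h * U' (ω + ψ) k * U' (ω + ψ) l)) := fun ω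
          => by ring
  simp_rw [e1]
  have i1 := (integrable_eC hΓ hΓop Y hUd hU₃c hU₃b hκ₀ hκ₁ ha hτ hδ hθ1 hκθ hstab hU'b ψ h k l)
  have i2 := (integrable_eAB hΓ hΓop Y hUd hU'c hU''c hU''b hκ₀ hκ₁ ha hτ hδ hθ1 hκθ hstab hU'b ψ k h l)
  have i3 := (integrable_eAB hΓ hΓop Y hUd hU'c hU''c hU''b hκ₀ hκ₁ ha hτ hδ hθ1 hκθ hstab hU'b ψ l h k)
  have i4 := (integrable_eAB hΓ hΓop Y hUd hU'c hU''c hU''b hκ₀ hκ₁ ha hτ hδ hθ1 hκθ hstab hU'b ψ h k l)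
  have i5 := (integrable_eAAA hΓ hΓop Y hUd hU'c hκ₀ hκ₁ ha hτ hδ hθ1 hκθ hstab hU'b ψ h k l)
  rw [integral_add (((i1.sub' i2).sub' i3).sub' i4) i5, integral_sub ((i1.sub' i2).sub' i3) i4, integral_sub (i1.sub' i2) i3, integral_sub i1 i2]

/-- `∫e·(C_mvw − A_vB_mw − A_wB_mv − (B_vw − A_vA_w)A_m)` split ((516)'s `H_{vw}′m`). [folklore] -/
theorem split_dH (hΓ : Γ.PosSemidef) (hΓop : (γop • (1 : Matrix ι ι ℝ) - Γ).PosSemidef) (Y : Finset ι)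
    (hUd : ∀ φ : EuclideanSpace ℝ ι, HasFDerivAt U (U' φ) φ) (hU'c : Continuous U') (hU''c : Continuous U'') (hU₃c : Continuous U₃) (hU''b : ∀ φ :
        EuclideanSpace ℝ ι, ‖U'' φ‖ ≤ κ₂) (hU₃b : ∀ φ : EuclideanSpace ℝ ι, ‖U₃ φ‖ ≤ κ₃)
    (hκ₀ : 0 ≤ κ₀) (hκ₁ : 0 ≤ κ₁) (ha : 0 ≤ a) (hτ : 0 < τ) (hδ : 0 < δ) (hθ1 : θ < 1) (hκθ : (2 * κ₀ * (1 + τ) + 4 * δ) * γop ≤ θ)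
    (hstab : ∀ φ : EuclideanSpace ℝ ι, -(κ₀ * ∑ x ∈ Y, φ x ^ 2) ≤ U φ) (hU'b : ∀ φ : EuclideanSpace ℝ ι, ‖U' φ‖ ≤ κ₁ * (a + ∑ x ∈ Y, φ x ^ 2)) (ψ :
        EuclideanSpace ℝ ι) (m v w : EuclideanSpace ℝ ι) :
    (∫ ω : EuclideanSpace ℝ ι, exp (-U (ω + ψ)) * (U₃ (ω + ψ) m v w - U' (ω + ψ) v * U'' (ω + ψ) m w - U' (ω + ψ) w * U'' (ω + ψ) m v -
        (U'' (ω + ψ) v w - U' (ω + ψ) v * U' (ω + ψ) w) * U' (ω + ψ) m) ∂(multivariateGaussian 0 Γ)) =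
      (∫ ω : EuclideanSpace ℝ ι, exp (-U (ω + ψ)) * U₃ (ω + ψ) m v w ∂(multivariateGaussian 0 Γ)) - (∫ ω : EuclideanSpace ℝ ι, exp (-U (ω + ψ)) *
          (U'' (ω + ψ) m w * U' (ω + ψ) v) ∂(multivariateGaussian 0 Γ)) - (∫ ω : EuclideanSpace ℝ ι, exp (-U (ω + ψ)) * (U'' (ω + ψ) m v * U' (ω + ψ)
          w) ∂(multivariateGaussian 0 Γ)) - (∫ ω : EuclideanSpace ℝ ι, exp (-U (ω + ψ)) * (U' (ω + ψ) m * U'' (ω + ψ) v w) ∂(multivariateGaussian 0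
          Γ)) + (∫ ω : EuclideanSpace ℝ ι, exp (-U (ω + ψ)) * (U' (ω + ψ) m * U' (ω + ψ) v * U' (ω + ψ) w) ∂(multivariateGaussian 0 Γ)) := by
  have e1 : ∀ ω : EuclideanSpace ℝ ι, exp (-U (ω + ψ)) * (U₃ (ω + ψ) m v w - U' (ω + ψ) v * U'' (ω + ψ) m w - U' (ω + ψ) w * U'' (ω + ψ) m v -
        (U'' (ω + ψ) v w - U' (ω + ψ) v * U' (ω + ψ) w) * U' (ω + ψ) m) =
      (exp (-U (ω + ψ)) * U₃ (ω + ψ) m v w) - (exp (-U (ω + ψ)) * (U'' (ω + ψ) m w * U' (ω + ψ) v)) - (exp (-U (ω + ψ)) * (U'' (ω + ψ) m v * U' (ω +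
          ψ) w)) - (exp (-U (ω + ψ)) * (U' (ω + ψ) m * U'' (ω + ψ) v w)) + (exp (-U (ω + ψ)) * (U' (ω + ψ) m * U' (ω + ψ) v * U' (ω + ψ) w)) := fun ω
          => by ring
  simp_rw [e1]
  have i1 := (integrable_eC hΓ hΓop Y hUd hU₃c hU₃b hκ₀ hκ₁ ha hτ hδ hθ1 hκθ hstab hU'b ψ m v w)
  have i2 := (integrable_eBA hΓ hΓop Y hUd hU'c hU''c hU''b hκ₀ hκ₁ ha hτ hδ hθ1 hκθ hstab hU'b ψ m w v)
  have i3 := (integrable_eBA hΓ hΓop Y hUd hU'c hU''c hU''b hκ₀ hκ₁ ha hτ hδ hθ1 hκθ hstab hU'b ψ m v w)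
  have i4 := (integrable_eAB hΓ hΓop Y hUd hU'c hU''c hU''b hκ₀ hκ₁ ha hτ hδ hθ1 hκθ hstab hU'b ψ m v w)
  have i5 := (integrable_eAAA hΓ hΓop Y hUd hU'c hκ₀ hκ₁ ha hτ hδ hθ1 hκθ hstab hU'b ψ m v w)
  rw [integral_add (((i1.sub' i2).sub' i3).sub' i4) i5, integral_sub ((i1.sub' i2).sub' i3) i4, integral_sub (i1.sub' i2) i3, integral_sub i1 i2]

/-- `∫e·Ψ_{hklm}` split into its fifteen canonical monomial integrals ((516)'s `Φ_{hkl}′m`). [folklore] -/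
theorem split_PSI (hΓ : Γ.PosSemidef) (hΓop : (γop • (1 : Matrix ι ι ℝ) - Γ).PosSemidef) (Y : Finset ι)
    (hUd : ∀ φ : EuclideanSpace ℝ ι, HasFDerivAt U (U' φ) φ) (hU'c : Continuous U') (hU''c : Continuous U'') (hU₃c : Continuous U₃) (hU₄c :
        Continuous U₄) (hU''b : ∀ φ : EuclideanSpace ℝ ι, ‖U'' φ‖ ≤ κ₂) (hU₃b : ∀ φ : EuclideanSpace ℝ ι, ‖U₃ φ‖ ≤ κ₃) (hU₄b : ∀ φ : EuclideanSpace ℝ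
        ι, ‖U₄ φ‖ ≤ κ₄)
    (hκ₀ : 0 ≤ κ₀) (hκ₁ : 0 ≤ κ₁) (ha : 0 ≤ a) (hτ : 0 < τ) (hδ : 0 < δ) (hθ1 : θ < 1) (hκθ : (2 * κ₀ * (1 + τ) + 4 * δ) * γop ≤ θ)
    (hstab : ∀ φ : EuclideanSpace ℝ ι, -(κ₀ * ∑ x ∈ Y, φ x ^ 2) ≤ U φ) (hU'b : ∀ φ : EuclideanSpace ℝ ι, ‖U' φ‖ ≤ κ₁ * (a + ∑ x ∈ Y, φ x ^ 2)) (ψ :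
        EuclideanSpace ℝ ι) (h k l m : EuclideanSpace ℝ ι) :
    (∫ ω : EuclideanSpace ℝ ι, exp (-U (ω + ψ)) * (U₄ (ω + ψ) m h k l - U' (ω + ψ) k * U₃ (ω + ψ) m h l - U'' (ω + ψ) h l * U'' (ω + ψ) m k - U'' (ω
        + ψ) h k * U'' (ω + ψ) m l - U' (ω + ψ) l * U₃ (ω + ψ) m h k -
        U' (ω + ψ) h * U₃ (ω + ψ) m k l - U'' (ω + ψ) k l * U'' (ω + ψ) m h + U' (ω + ψ) h * U' (ω + ψ) k * U'' (ω + ψ) m l + U' (ω + ψ) h * U' (ω +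
            ψ) l * U'' (ω + ψ) m k +
        U' (ω + ψ) k * U' (ω + ψ) l * U'' (ω + ψ) m h - (U₃ (ω + ψ) h k l - U' (ω + ψ) k * U'' (ω + ψ) h l - U'' (ω + ψ) h k * U' (ω + ψ) l - U' (ω +
            ψ) h * U'' (ω + ψ) k l + U' (ω + ψ) h * U' (ω + ψ) k * U' (ω + ψ) l) * U' (ω + ψ) m) ∂(multivariateGaussian 0 Γ)) =
      (∫ ω : EuclideanSpace ℝ ι, exp (-U (ω + ψ)) * U₄ (ω + ψ) m h k l ∂(multivariateGaussian 0 Γ)) - (∫ ω : EuclideanSpace ℝ ι, exp (-U (ω + ψ)) *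
          (U₃ (ω + ψ) m h l * U' (ω + ψ) k) ∂(multivariateGaussian 0 Γ)) - (∫ ω : EuclideanSpace ℝ ι, exp (-U (ω + ψ)) * (U'' (ω + ψ) m k * U'' (ω +
          ψ) h l) ∂(multivariateGaussian 0 Γ)) - (∫ ω : EuclideanSpace ℝ ι, exp (-U (ω + ψ)) * (U'' (ω + ψ) m l * U'' (ω + ψ) h k)
          ∂(multivariateGaussian 0 Γ)) - (∫ ω : EuclideanSpace ℝ ι, exp (-U (ω + ψ)) * (U₃ (ω + ψ) m h k * U' (ω + ψ) l) ∂(multivariateGaussian 0 Γ))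
          - (∫ ω : EuclideanSpace ℝ ι, exp (-U (ω + ψ)) * (U₃ (ω + ψ) m k l * U' (ω + ψ) h) ∂(multivariateGaussian 0 Γ)) - (∫ ω : EuclideanSpace ℝ ι,
          exp (-U (ω + ψ)) * (U'' (ω + ψ) m h * U'' (ω + ψ) k l) ∂(multivariateGaussian 0 Γ)) + (∫ ω : EuclideanSpace ℝ ι, exp (-U (ω + ψ)) * (U'' (ω
          + ψ) m l * U' (ω + ψ) h * U' (ω + ψ) k) ∂(multivariateGaussian 0 Γ)) + (∫ ω : EuclideanSpace ℝ ι, exp (-U (ω + ψ)) * (U'' (ω + ψ) m k * U'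
          (ω + ψ) h * U' (ω + ψ) l) ∂(multivariateGaussian 0 Γ)) + (∫ ω : EuclideanSpace ℝ ι, exp (-U (ω + ψ)) * (U'' (ω + ψ) m h * U' (ω + ψ) k * U'
          (ω + ψ) l) ∂(multivariateGaussian 0 Γ)) - (∫ ω : EuclideanSpace ℝ ι, exp (-U (ω + ψ)) * (U' (ω + ψ) m * U₃ (ω + ψ) h k l)
          ∂(multivariateGaussian 0 Γ)) + (∫ ω : EuclideanSpace ℝ ι, exp (-U (ω + ψ)) * (U' (ω + ψ) m * U' (ω + ψ) k * U'' (ω + ψ) h l)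
          ∂(multivariateGaussian 0 Γ)) + (∫ ω : EuclideanSpace ℝ ι, exp (-U (ω + ψ)) * (U' (ω + ψ) m * U' (ω + ψ) l * U'' (ω + ψ) h k)
          ∂(multivariateGaussian 0 Γ)) + (∫ ω : EuclideanSpace ℝ ι, exp (-U (ω + ψ)) * (U' (ω + ψ) m * U' (ω + ψ) h * U'' (ω + ψ) k l)
          ∂(multivariateGaussian 0 Γ)) - (∫ ω : EuclideanSpace ℝ ι, exp (-U (ω + ψ)) * (U' (ω + ψ) m * U' (ω + ψ) h * U' (ω + ψ) k * U' (ω + ψ) l)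
          ∂(multivariateGaussian 0 Γ)) := by
  have e1 : ∀ ω : EuclideanSpace ℝ ι, exp (-U (ω + ψ)) * (U₄ (ω + ψ) m h k l - U' (ω + ψ) k * U₃ (ω + ψ) m h l - U'' (ω + ψ) h l * U'' (ω + ψ) m k -
      U'' (ω + ψ) h k * U'' (ω + ψ) m l - U' (ω + ψ) l * U₃ (ω + ψ) m h k -
        U' (ω + ψ) h * U₃ (ω + ψ) m k l - U'' (ω + ψ) k l * U'' (ω + ψ) m h + U' (ω + ψ) h * U' (ω + ψ) k * U'' (ω + ψ) m l + U' (ω + ψ) h * U' (ω +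
            ψ) l * U'' (ω + ψ) m k +
        U' (ω + ψ) k * U' (ω + ψ) l * U'' (ω + ψ) m h - (U₃ (ω + ψ) h k l - U' (ω + ψ) k * U'' (ω + ψ) h l - U'' (ω + ψ) h k * U' (ω + ψ) l - U' (ω +
            ψ) h * U'' (ω + ψ) k l + U' (ω + ψ) h * U' (ω + ψ) k * U' (ω + ψ) l) * U' (ω + ψ) m) =
      (exp (-U (ω + ψ)) * U₄ (ω + ψ) m h k l) - (exp (-U (ω + ψ)) * (U₃ (ω + ψ) m h l * U' (ω + ψ) k)) - (exp (-U (ω + ψ)) * (U'' (ω + ψ) m k * U''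
          (ω + ψ) h l)) - (exp (-U (ω + ψ)) * (U'' (ω + ψ) m l * U'' (ω + ψ) h k)) - (exp (-U (ω + ψ)) * (U₃ (ω + ψ) m h k * U' (ω + ψ) l)) - (exp
          (-U (ω + ψ)) * (U₃ (ω + ψ) m k l * U' (ω + ψ) h)) - (exp (-U (ω + ψ)) * (U'' (ω + ψ) m h * U'' (ω + ψ) k l)) + (exp (-U (ω + ψ)) * (U'' (ω
          + ψ) m l * U' (ω + ψ) h * U' (ω + ψ) k)) + (exp (-U (ω + ψ)) * (U'' (ω + ψ) m k * U' (ω + ψ) h * U' (ω + ψ) l)) + (exp (-U (ω + ψ)) * (U''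
          (ω + ψ) m h * U' (ω + ψ) k * U' (ω + ψ) l)) - (exp (-U (ω + ψ)) * (U' (ω + ψ) m * U₃ (ω + ψ) h k l)) + (exp (-U (ω + ψ)) * (U' (ω + ψ) m *
          U' (ω + ψ) k * U'' (ω + ψ) h l)) + (exp (-U (ω + ψ)) * (U' (ω + ψ) m * U' (ω + ψ) l * U'' (ω + ψ) h k)) + (exp (-U (ω + ψ)) * (U' (ω + ψ) m
          * U' (ω + ψ) h * U'' (ω + ψ) k l)) - (exp (-U (ω + ψ)) * (U' (ω + ψ) m * U' (ω + ψ) h * U' (ω + ψ) k * U' (ω + ψ) l)) := fun ω => by ring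
  simp_rw [e1]
  have i1 := (integrable_eD hΓ hΓop Y hUd hU₄c hU₄b hκ₀ hκ₁ ha hτ hδ hθ1 hκθ hstab hU'b ψ m h k l)
  have i2 := (integrable_eCA hΓ hΓop Y hUd hU'c hU₃c hU₃b hκ₀ hκ₁ ha hτ hδ hθ1 hκθ hstab hU'b ψ m h l k)
  have i3 := (integrable_eBB hΓ hΓop Y hUd hU''c hU''b hκ₀ hκ₁ ha hτ hδ hθ1 hκθ hstab hU'b ψ m k h l)
  have i4 := (integrable_eBB hΓ hΓop Y hUd hU''c hU''b hκ₀ hκ₁ ha hτ hδ hθ1 hκθ hstab hU'b ψ m l h k)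
  have i5 := (integrable_eCA hΓ hΓop Y hUd hU'c hU₃c hU₃b hκ₀ hκ₁ ha hτ hδ hθ1 hκθ hstab hU'b ψ m h k l)
  have i6 := (integrable_eCA hΓ hΓop Y hUd hU'c hU₃c hU₃b hκ₀ hκ₁ ha hτ hδ hθ1 hκθ hstab hU'b ψ m k l h)
  have i7 := (integrable_eBB hΓ hΓop Y hUd hU''c hU''b hκ₀ hκ₁ ha hτ hδ hθ1 hκθ hstab hU'b ψ m h k l)
  have i8 := (integrable_eBAA hΓ hΓop Y hUd hU'c hU''c hU''b hκ₀ hκ₁ ha hτ hδ hθ1 hκθ hstab hU'b ψ m l h k)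
  have i9 := (integrable_eBAA hΓ hΓop Y hUd hU'c hU''c hU''b hκ₀ hκ₁ ha hτ hδ hθ1 hκθ hstab hU'b ψ m k h l)
  have i10 := (integrable_eBAA hΓ hΓop Y hUd hU'c hU''c hU''b hκ₀ hκ₁ ha hτ hδ hθ1 hκθ hstab hU'b ψ m h k l)
  have i11 := (integrable_eAC hΓ hΓop Y hUd hU'c hU₃c hU₃b hκ₀ hκ₁ ha hτ hδ hθ1 hκθ hstab hU'b ψ m h k l)
  have i12 := (integrable_eAAB hΓ hΓop Y hUd hU'c hU''c hU''b hκ₀ hκ₁ ha hτ hδ hθ1 hκθ hstab hU'b ψ m k h l)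
  have i13 := (integrable_eAAB hΓ hΓop Y hUd hU'c hU''c hU''b hκ₀ hκ₁ ha hτ hδ hθ1 hκθ hstab hU'b ψ m l h k)
  have i14 := (integrable_eAAB hΓ hΓop Y hUd hU'c hU''c hU''b hκ₀ hκ₁ ha hτ hδ hθ1 hκθ hstab hU'b ψ m h k l)
  have i15 := (integrable_eAAAA hΓ hΓop Y hUd hU'c hκ₀ hκ₁ ha hτ hδ hθ1 hκθ hstab hU'b ψ m h k l)
  rw [integral_sub (((((((((((((i1.sub' i2).sub' i3).sub' i4).sub' i5).sub' i6).sub' i7).fun_add i8).fun_add i9).fun_add i10).sub' i11).fun_add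
      i12).fun_add i13).fun_add i14) i15, integral_add ((((((((((((i1.sub' i2).sub' i3).sub' i4).sub' i5).sub' i6).sub' i7).fun_add i8).fun_add
      i9).fun_add i10).sub' i11).fun_add i12).fun_add i13) i14, integral_add (((((((((((i1.sub' i2).sub' i3).sub' i4).sub' i5).sub' i6).sub'
      i7).fun_add i8).fun_add i9).fun_add i10).sub' i11).fun_add i12) i13, integral_add ((((((((((i1.sub' i2).sub' i3).sub' i4).sub' i5).sub'
      i6).sub' i7).fun_add i8).fun_add i9).fun_add i10).sub' i11) i12, integral_sub (((((((((i1.sub' i2).sub' i3).sub' i4).sub' i5).sub' i6).sub'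
      i7).fun_add i8).fun_add i9).fun_add i10) i11, integral_add ((((((((i1.sub' i2).sub' i3).sub' i4).sub' i5).sub' i6).sub' i7).fun_add i8).fun_add
      i9) i10, integral_add (((((((i1.sub' i2).sub' i3).sub' i4).sub' i5).sub' i6).sub' i7).fun_add i8) i9, integral_add ((((((i1.sub' i2).sub'
      i3).sub' i4).sub' i5).sub' i6).sub' i7) i8, integral_sub (((((i1.sub' i2).sub' i3).sub' i4).sub' i5).sub' i6) i7, integral_sub ((((i1.sub'
      i2).sub' i3).sub' i4).sub' i5) i6, integral_sub (((i1.sub' i2).sub' i3).sub' i4) i5, integral_sub ((i1.sub' i2).sub' i3) i4, integral_sub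
      (i1.sub' i2) i3, integral_sub i1 i2]

/-! ## §2. The centred side -/

/-- The centred triple with the Hessian entry FIRST: `∫e(B_mq − b)(A_v − a)(A_w − a′)` split (eight terms). [folklore] -/
theorem split_tripleB (hΓ : Γ.PosSemidef) (hΓop : (γop • (1 : Matrix ι ι ℝ) - Γ).PosSemidef) (Y : Finset ι)
    (hUd : ∀ φ : EuclideanSpace ℝ ι, HasFDerivAt U (U' φ) φ) (hU'c : Continuous U') (hU''c : Continuous U'') (hU''b : ∀ φ : EuclideanSpace ℝ ι, ‖U''
        φ‖ ≤ κ₂)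
    (hκ₀ : 0 ≤ κ₀) (hκ₁ : 0 ≤ κ₁) (ha : 0 ≤ a) (hτ : 0 < τ) (hδ : 0 < δ) (hθ1 : θ < 1) (hκθ : (2 * κ₀ * (1 + τ) + 4 * δ) * γop ≤ θ)
    (hstab : ∀ φ : EuclideanSpace ℝ ι, -(κ₀ * ∑ x ∈ Y, φ x ^ 2) ≤ U φ) (hU'b : ∀ φ : EuclideanSpace ℝ ι, ‖U' φ‖ ≤ κ₁ * (a + ∑ x ∈ Y, φ x ^ 2)) (ψ :
        EuclideanSpace ℝ ι) (m q v w : EuclideanSpace ℝ ι) (b a a' : ℝ) :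
    (∫ ω : EuclideanSpace ℝ ι, exp (-U (ω + ψ)) * ((U'' (ω + ψ) m q - b) * (U' (ω + ψ) v - a) * (U' (ω + ψ) w - a')) ∂(multivariateGaussian 0 Γ)) =
      (∫ ω : EuclideanSpace ℝ ι, exp (-U (ω + ψ)) * (U'' (ω + ψ) m q * U' (ω + ψ) v * U' (ω + ψ) w) ∂(multivariateGaussian 0 Γ)) - a' * (∫ ω :
          EuclideanSpace ℝ ι, exp (-U (ω + ψ)) * (U'' (ω + ψ) m q * U' (ω + ψ) v) ∂(multivariateGaussian 0 Γ)) - a * (∫ ω : EuclideanSpace ℝ ι, exp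
          (-U (ω + ψ)) * (U'' (ω + ψ) m q * U' (ω + ψ) w) ∂(multivariateGaussian 0 Γ)) + a * a' * (∫ ω : EuclideanSpace ℝ ι, exp (-U (ω + ψ)) * U''
          (ω + ψ) m q ∂(multivariateGaussian 0 Γ)) - b * (∫ ω : EuclideanSpace ℝ ι, exp (-U (ω + ψ)) * (U' (ω + ψ) v * U' (ω + ψ) w)
          ∂(multivariateGaussian 0 Γ)) + a' * b * (∫ ω : EuclideanSpace ℝ ι, exp (-U (ω + ψ)) * U' (ω + ψ) v ∂(multivariateGaussian 0 Γ)) + a * b *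
          (∫ ω : EuclideanSpace ℝ ι, exp (-U (ω + ψ)) * U' (ω + ψ) w ∂(multivariateGaussian 0 Γ)) - a * a' * b * (∫ ω : EuclideanSpace ℝ ι, exp (-U
          (ω + ψ)) ∂(multivariateGaussian 0 Γ)) := by
  have e1 : ∀ ω : EuclideanSpace ℝ ι, exp (-U (ω + ψ)) * ((U'' (ω + ψ) m q - b) * (U' (ω + ψ) v - a) * (U' (ω + ψ) w - a')) =
      (exp (-U (ω + ψ)) * (U'' (ω + ψ) m q * U' (ω + ψ) v * U' (ω + ψ) w)) - a' * (exp (-U (ω + ψ)) * (U'' (ω + ψ) m q * U' (ω + ψ) v)) - a * (exp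
          (-U (ω + ψ)) * (U'' (ω + ψ) m q * U' (ω + ψ) w)) + a * a' * (exp (-U (ω + ψ)) * U'' (ω + ψ) m q) - b * (exp (-U (ω + ψ)) * (U' (ω + ψ) v *
          U' (ω + ψ) w)) + a' * b * (exp (-U (ω + ψ)) * U' (ω + ψ) v) + a * b * (exp (-U (ω + ψ)) * U' (ω + ψ) w) - a * a' * b * exp (-U (ω + ψ)) :=
          fun ω => by ring
  simp_rw [e1]
  have i1 := (integrable_eBAA hΓ hΓop Y hUd hU'c hU''c hU''b hκ₀ hκ₁ ha hτ hδ hθ1 hκθ hstab hU'b ψ m q v w)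
  have i2 := ((integrable_eBA hΓ hΓop Y hUd hU'c hU''c hU''b hκ₀ hκ₁ ha hτ hδ hθ1 hκθ hstab hU'b ψ m q v).const_mul (a'))
  have i3 := ((integrable_eBA hΓ hΓop Y hUd hU'c hU''c hU''b hκ₀ hκ₁ ha hτ hδ hθ1 hκθ hstab hU'b ψ m q w).const_mul (a))
  have i4 := ((integrable_eB hΓ hΓop Y hUd hU''c hU''b hκ₀ hκ₁ ha hτ hδ hθ1 hκθ hstab hU'b ψ m q).const_mul (a * a'))
  have i5 := ((integrable_eAA hΓ hΓop Y hUd hU'c hκ₀ hκ₁ ha hτ hδ hθ1 hκθ hstab hU'b ψ v w).const_mul (b))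
  have i6 := ((integrable_weighted_blockDeriv_apply hΓ hΓop Y hUd hU'c hκ₀ hκ₁ ha hτ hδ hθ1 hκθ hstab hU'b ψ v).const_mul (a' * b))
  have i7 := ((integrable_weighted_blockDeriv_apply hΓ hΓop Y hUd hU'c hκ₀ hκ₁ ha hτ hδ hθ1 hκθ hstab hU'b ψ w).const_mul (a * b))
  have i8 := ((integrable_e hΓ hΓop Y hUd hκ₀ hκ₁ ha hτ hδ hθ1 hκθ hstab hU'b ψ).const_mul (a * a' * b))
  rw [integral_sub ((((((i1.sub' i2).sub' i3).fun_add i4).sub' i5).fun_add i6).fun_add i7) i8, integral_add (((((i1.sub' i2).sub' i3).fun_add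
      i4).sub' i5).fun_add i6) i7, integral_add ((((i1.sub' i2).sub' i3).fun_add i4).sub' i5) i6, integral_sub (((i1.sub' i2).sub' i3).fun_add i4)
      i5, integral_add ((i1.sub' i2).sub' i3) i4, integral_sub (i1.sub' i2) i3, integral_sub i1 i2]
  simp only [integral_const_mul]

/-- The centred triple with the `m`-gradient entry first: `∫e(A_m − a)(B_pq − b)(A_w − a′)` split (eight terms). [folklore] -/
theorem split_tripleA (hΓ : Γ.PosSemidef) (hΓop : (γop • (1 : Matrix ι ι ℝ) - Γ).PosSemidef) (Y : Finset ι)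
    (hUd : ∀ φ : EuclideanSpace ℝ ι, HasFDerivAt U (U' φ) φ) (hU'c : Continuous U') (hU''c : Continuous U'') (hU''b : ∀ φ : EuclideanSpace ℝ ι, ‖U''
        φ‖ ≤ κ₂)
    (hκ₀ : 0 ≤ κ₀) (hκ₁ : 0 ≤ κ₁) (ha : 0 ≤ a) (hτ : 0 < τ) (hδ : 0 < δ) (hθ1 : θ < 1) (hκθ : (2 * κ₀ * (1 + τ) + 4 * δ) * γop ≤ θ)
    (hstab : ∀ φ : EuclideanSpace ℝ ι, -(κ₀ * ∑ x ∈ Y, φ x ^ 2) ≤ U φ) (hU'b : ∀ φ : EuclideanSpace ℝ ι, ‖U' φ‖ ≤ κ₁ * (a + ∑ x ∈ Y, φ x ^ 2)) (ψ :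
        EuclideanSpace ℝ ι) (m p q w : EuclideanSpace ℝ ι) (a b a' : ℝ) :
    (∫ ω : EuclideanSpace ℝ ι, exp (-U (ω + ψ)) * ((U' (ω + ψ) m - a) * (U'' (ω + ψ) p q - b) * (U' (ω + ψ) w - a')) ∂(multivariateGaussian 0 Γ)) =
      (∫ ω : EuclideanSpace ℝ ι, exp (-U (ω + ψ)) * (U' (ω + ψ) m * U' (ω + ψ) w * U'' (ω + ψ) p q) ∂(multivariateGaussian 0 Γ)) - a' * (∫ ω :
          EuclideanSpace ℝ ι, exp (-U (ω + ψ)) * (U' (ω + ψ) m * U'' (ω + ψ) p q) ∂(multivariateGaussian 0 Γ)) - b * (∫ ω : EuclideanSpace ℝ ι, exp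
          (-U (ω + ψ)) * (U' (ω + ψ) m * U' (ω + ψ) w) ∂(multivariateGaussian 0 Γ)) + a' * b * (∫ ω : EuclideanSpace ℝ ι, exp (-U (ω + ψ)) * U' (ω +
          ψ) m ∂(multivariateGaussian 0 Γ)) - a * (∫ ω : EuclideanSpace ℝ ι, exp (-U (ω + ψ)) * (U' (ω + ψ) w * U'' (ω + ψ) p q)
          ∂(multivariateGaussian 0 Γ)) + a * a' * (∫ ω : EuclideanSpace ℝ ι, exp (-U (ω + ψ)) * U'' (ω + ψ) p q ∂(multivariateGaussian 0 Γ)) + a * b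
          * (∫ ω : EuclideanSpace ℝ ι, exp (-U (ω + ψ)) * U' (ω + ψ) w ∂(multivariateGaussian 0 Γ)) - a * a' * b * (∫ ω : EuclideanSpace ℝ ι, exp (-U
          (ω + ψ)) ∂(multivariateGaussian 0 Γ)) := by
  have e1 : ∀ ω : EuclideanSpace ℝ ι, exp (-U (ω + ψ)) * ((U' (ω + ψ) m - a) * (U'' (ω + ψ) p q - b) * (U' (ω + ψ) w - a')) =
      (exp (-U (ω + ψ)) * (U' (ω + ψ) m * U' (ω + ψ) w * U'' (ω + ψ) p q)) - a' * (exp (-U (ω + ψ)) * (U' (ω + ψ) m * U'' (ω + ψ) p q)) - b * (exp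
          (-U (ω + ψ)) * (U' (ω + ψ) m * U' (ω + ψ) w)) + a' * b * (exp (-U (ω + ψ)) * U' (ω + ψ) m) - a * (exp (-U (ω + ψ)) * (U' (ω + ψ) w * U'' (ω
          + ψ) p q)) + a * a' * (exp (-U (ω + ψ)) * U'' (ω + ψ) p q) + a * b * (exp (-U (ω + ψ)) * U' (ω + ψ) w) - a * a' * b * exp (-U (ω + ψ)) :=
          fun ω => by ring
  simp_rw [e1]
  have i1 := (integrable_eAAB hΓ hΓop Y hUd hU'c hU''c hU''b hκ₀ hκ₁ ha hτ hδ hθ1 hκθ hstab hU'b ψ m w p q)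
  have i2 := ((integrable_eAB hΓ hΓop Y hUd hU'c hU''c hU''b hκ₀ hκ₁ ha hτ hδ hθ1 hκθ hstab hU'b ψ m p q).const_mul (a'))
  have i3 := ((integrable_eAA hΓ hΓop Y hUd hU'c hκ₀ hκ₁ ha hτ hδ hθ1 hκθ hstab hU'b ψ m w).const_mul (b))
  have i4 := ((integrable_weighted_blockDeriv_apply hΓ hΓop Y hUd hU'c hκ₀ hκ₁ ha hτ hδ hθ1 hκθ hstab hU'b ψ m).const_mul (a' * b))
  have i5 := ((integrable_eAB hΓ hΓop Y hUd hU'c hU''c hU''b hκ₀ hκ₁ ha hτ hδ hθ1 hκθ hstab hU'b ψ w p q).const_mul (a))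
  have i6 := ((integrable_eB hΓ hΓop Y hUd hU''c hU''b hκ₀ hκ₁ ha hτ hδ hθ1 hκθ hstab hU'b ψ p q).const_mul (a * a'))
  have i7 := ((integrable_weighted_blockDeriv_apply hΓ hΓop Y hUd hU'c hκ₀ hκ₁ ha hτ hδ hθ1 hκθ hstab hU'b ψ w).const_mul (a * b))
  have i8 := ((integrable_e hΓ hΓop Y hUd hκ₀ hκ₁ ha hτ hδ hθ1 hκθ hstab hU'b ψ).const_mul (a * a' * b))
  rw [integral_sub ((((((i1.sub' i2).sub' i3).fun_add i4).sub' i5).fun_add i6).fun_add i7) i8, integral_add (((((i1.sub' i2).sub' i3).fun_add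
      i4).sub' i5).fun_add i6) i7, integral_add ((((i1.sub' i2).sub' i3).fun_add i4).sub' i5) i6, integral_sub (((i1.sub' i2).sub' i3).fun_add i4)
      i5, integral_add ((i1.sub' i2).sub' i3) i4, integral_sub (i1.sub' i2) i3, integral_sub i1 i2]
  simp only [integral_const_mul]

/-- The centred pair `∫e(A_v − a)(A_w − a′)` split (four terms). [folklore] -/
theorem split_pair (hΓ : Γ.PosSemidef) (hΓop : (γop • (1 : Matrix ι ι ℝ) - Γ).PosSemidef) (Y : Finset ι)
    (hUd : ∀ φ : EuclideanSpace ℝ ι, HasFDerivAt U (U' φ) φ) (hU'c : Continuous U')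
    (hκ₀ : 0 ≤ κ₀) (hκ₁ : 0 ≤ κ₁) (ha : 0 ≤ a) (hτ : 0 < τ) (hδ : 0 < δ) (hθ1 : θ < 1) (hκθ : (2 * κ₀ * (1 + τ) + 4 * δ) * γop ≤ θ)
    (hstab : ∀ φ : EuclideanSpace ℝ ι, -(κ₀ * ∑ x ∈ Y, φ x ^ 2) ≤ U φ) (hU'b : ∀ φ : EuclideanSpace ℝ ι, ‖U' φ‖ ≤ κ₁ * (a + ∑ x ∈ Y, φ x ^ 2)) (ψ :
        EuclideanSpace ℝ ι) (v w : EuclideanSpace ℝ ι) (a a' : ℝ) :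
    (∫ ω : EuclideanSpace ℝ ι, exp (-U (ω + ψ)) * ((U' (ω + ψ) v - a) * (U' (ω + ψ) w - a')) ∂(multivariateGaussian 0 Γ)) =
      (∫ ω : EuclideanSpace ℝ ι, exp (-U (ω + ψ)) * (U' (ω + ψ) v * U' (ω + ψ) w) ∂(multivariateGaussian 0 Γ)) - a' * (∫ ω : EuclideanSpace ℝ ι, exp
          (-U (ω + ψ)) * U' (ω + ψ) v ∂(multivariateGaussian 0 Γ)) - a * (∫ ω : EuclideanSpace ℝ ι, exp (-U (ω + ψ)) * U' (ω + ψ) w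
          ∂(multivariateGaussian 0 Γ)) + a * a' * (∫ ω : EuclideanSpace ℝ ι, exp (-U (ω + ψ)) ∂(multivariateGaussian 0 Γ)) := by
  have e1 : ∀ ω : EuclideanSpace ℝ ι, exp (-U (ω + ψ)) * ((U' (ω + ψ) v - a) * (U' (ω + ψ) w - a')) =
      (exp (-U (ω + ψ)) * (U' (ω + ψ) v * U' (ω + ψ) w)) - a' * (exp (-U (ω + ψ)) * U' (ω + ψ) v) - a * (exp (-U (ω + ψ)) * U' (ω + ψ) w) + a * a' *
          exp (-U (ω + ψ)) := fun ω => by ring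
  simp_rw [e1]
  have i1 := (integrable_eAA hΓ hΓop Y hUd hU'c hκ₀ hκ₁ ha hτ hδ hθ1 hκθ hstab hU'b ψ v w)
  have i2 := ((integrable_weighted_blockDeriv_apply hΓ hΓop Y hUd hU'c hκ₀ hκ₁ ha hτ hδ hθ1 hκθ hstab hU'b ψ v).const_mul (a'))
  have i3 := ((integrable_weighted_blockDeriv_apply hΓ hΓop Y hUd hU'c hκ₀ hκ₁ ha hτ hδ hθ1 hκθ hstab hU'b ψ w).const_mul (a))
  have i4 := ((integrable_e hΓ hΓop Y hUd hκ₀ hκ₁ ha hτ hδ hθ1 hκθ hstab hU'b ψ).const_mul (a * a'))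
  rw [integral_add ((i1.sub' i2).sub' i3) i4, integral_sub (i1.sub' i2) i3, integral_sub i1 i2]
  simp only [integral_const_mul]

/-- The centred quadruple `∫e(A_m − a)(A_h − b)(A_k − c)(A_l − d)` split (sixteen terms). [folklore] -/
theorem split_quad (hΓ : Γ.PosSemidef) (hΓop : (γop • (1 : Matrix ι ι ℝ) - Γ).PosSemidef) (Y : Finset ι)
    (hUd : ∀ φ : EuclideanSpace ℝ ι, HasFDerivAt U (U' φ) φ) (hU'c : Continuous U')
    (hκ₀ : 0 ≤ κ₀) (hκ₁ : 0 ≤ κ₁) (ha : 0 ≤ a) (hτ : 0 < τ) (hδ : 0 < δ) (hθ1 : θ < 1) (hκθ : (2 * κ₀ * (1 + τ) + 4 * δ) * γop ≤ θ)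
    (hstab : ∀ φ : EuclideanSpace ℝ ι, -(κ₀ * ∑ x ∈ Y, φ x ^ 2) ≤ U φ) (hU'b : ∀ φ : EuclideanSpace ℝ ι, ‖U' φ‖ ≤ κ₁ * (a + ∑ x ∈ Y, φ x ^ 2)) (ψ :
        EuclideanSpace ℝ ι) (m h k l : EuclideanSpace ℝ ι) (a b c d : ℝ) :
    (∫ ω : EuclideanSpace ℝ ι, exp (-U (ω + ψ)) * ((U' (ω + ψ) m - a) * (U' (ω + ψ) h - b) * (U' (ω + ψ) k - c) * (U' (ω + ψ) l - d))
        ∂(multivariateGaussian 0 Γ)) =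
      (∫ ω : EuclideanSpace ℝ ι, exp (-U (ω + ψ)) * (U' (ω + ψ) m * U' (ω + ψ) h * U' (ω + ψ) k * U' (ω + ψ) l) ∂(multivariateGaussian 0 Γ)) - d * (∫
          ω : EuclideanSpace ℝ ι, exp (-U (ω + ψ)) * (U' (ω + ψ) m * U' (ω + ψ) h * U' (ω + ψ) k) ∂(multivariateGaussian 0 Γ)) - c * (∫ ω :
          EuclideanSpace ℝ ι, exp (-U (ω + ψ)) * (U' (ω + ψ) m * U' (ω + ψ) h * U' (ω + ψ) l) ∂(multivariateGaussian 0 Γ)) + c * d * (∫ ω :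
          EuclideanSpace ℝ ι, exp (-U (ω + ψ)) * (U' (ω + ψ) m * U' (ω + ψ) h) ∂(multivariateGaussian 0 Γ)) - b * (∫ ω : EuclideanSpace ℝ ι, exp (-U
          (ω + ψ)) * (U' (ω + ψ) m * U' (ω + ψ) k * U' (ω + ψ) l) ∂(multivariateGaussian 0 Γ)) + b * d * (∫ ω : EuclideanSpace ℝ ι, exp (-U (ω + ψ))
          * (U' (ω + ψ) m * U' (ω + ψ) k) ∂(multivariateGaussian 0 Γ)) + b * c * (∫ ω : EuclideanSpace ℝ ι, exp (-U (ω + ψ)) * (U' (ω + ψ) m * U' (ω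
          + ψ) l) ∂(multivariateGaussian 0 Γ)) - b * c * d * (∫ ω : EuclideanSpace ℝ ι, exp (-U (ω + ψ)) * U' (ω + ψ) m ∂(multivariateGaussian 0 Γ))
          - a * (∫ ω : EuclideanSpace ℝ ι, exp (-U (ω + ψ)) * (U' (ω + ψ) h * U' (ω + ψ) k * U' (ω + ψ) l) ∂(multivariateGaussian 0 Γ)) + a * d * (∫
          ω : EuclideanSpace ℝ ι, exp (-U (ω + ψ)) * (U' (ω + ψ) h * U' (ω + ψ) k) ∂(multivariateGaussian 0 Γ)) + a * c * (∫ ω : EuclideanSpace ℝ ι,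
          exp (-U (ω + ψ)) * (U' (ω + ψ) h * U' (ω + ψ) l) ∂(multivariateGaussian 0 Γ)) - a * c * d * (∫ ω : EuclideanSpace ℝ ι, exp (-U (ω + ψ)) *
          U' (ω + ψ) h ∂(multivariateGaussian 0 Γ)) + a * b * (∫ ω : EuclideanSpace ℝ ι, exp (-U (ω + ψ)) * (U' (ω + ψ) k * U' (ω + ψ) l)
          ∂(multivariateGaussian 0 Γ)) - a * b * d * (∫ ω : EuclideanSpace ℝ ι, exp (-U (ω + ψ)) * U' (ω + ψ) k ∂(multivariateGaussian 0 Γ)) - a * b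
          * c * (∫ ω : EuclideanSpace ℝ ι, exp (-U (ω + ψ)) * U' (ω + ψ) l ∂(multivariateGaussian 0 Γ)) + a * b * c * d * (∫ ω : EuclideanSpace ℝ ι,
          exp (-U (ω + ψ)) ∂(multivariateGaussian 0 Γ)) := by
  have e1 : ∀ ω : EuclideanSpace ℝ ι, exp (-U (ω + ψ)) * ((U' (ω + ψ) m - a) * (U' (ω + ψ) h - b) * (U' (ω + ψ) k - c) * (U' (ω + ψ) l - d)) =
      (exp (-U (ω + ψ)) * (U' (ω + ψ) m * U' (ω + ψ) h * U' (ω + ψ) k * U' (ω + ψ) l)) - d * (exp (-U (ω + ψ)) * (U' (ω + ψ) m * U' (ω + ψ) h * U' (ω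
          + ψ) k)) - c * (exp (-U (ω + ψ)) * (U' (ω + ψ) m * U' (ω + ψ) h * U' (ω + ψ) l)) + c * d * (exp (-U (ω + ψ)) * (U' (ω + ψ) m * U' (ω + ψ)
          h)) - b * (exp (-U (ω + ψ)) * (U' (ω + ψ) m * U' (ω + ψ) k * U' (ω + ψ) l)) + b * d * (exp (-U (ω + ψ)) * (U' (ω + ψ) m * U' (ω + ψ) k)) +
          b * c * (exp (-U (ω + ψ)) * (U' (ω + ψ) m * U' (ω + ψ) l)) - b * c * d * (exp (-U (ω + ψ)) * U' (ω + ψ) m) - a * (exp (-U (ω + ψ)) * (U' (ω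
          + ψ) h * U' (ω + ψ) k * U' (ω + ψ) l)) + a * d * (exp (-U (ω + ψ)) * (U' (ω + ψ) h * U' (ω + ψ) k)) + a * c * (exp (-U (ω + ψ)) * (U' (ω +
          ψ) h * U' (ω + ψ) l)) - a * c * d * (exp (-U (ω + ψ)) * U' (ω + ψ) h) + a * b * (exp (-U (ω + ψ)) * (U' (ω + ψ) k * U' (ω + ψ) l)) - a * b
          * d * (exp (-U (ω + ψ)) * U' (ω + ψ) k) - a * b * c * (exp (-U (ω + ψ)) * U' (ω + ψ) l) + a * b * c * d * exp (-U (ω + ψ)) := fun ω => by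
          ring
  simp_rw [e1]
  have i1 := (integrable_eAAAA hΓ hΓop Y hUd hU'c hκ₀ hκ₁ ha hτ hδ hθ1 hκθ hstab hU'b ψ m h k l)
  have i2 := ((integrable_eAAA hΓ hΓop Y hUd hU'c hκ₀ hκ₁ ha hτ hδ hθ1 hκθ hstab hU'b ψ m h k).const_mul (d))
  have i3 := ((integrable_eAAA hΓ hΓop Y hUd hU'c hκ₀ hκ₁ ha hτ hδ hθ1 hκθ hstab hU'b ψ m h l).const_mul (c))
  have i4 := ((integrable_eAA hΓ hΓop Y hUd hU'c hκ₀ hκ₁ ha hτ hδ hθ1 hκθ hstab hU'b ψ m h).const_mul (c * d))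
  have i5 := ((integrable_eAAA hΓ hΓop Y hUd hU'c hκ₀ hκ₁ ha hτ hδ hθ1 hκθ hstab hU'b ψ m k l).const_mul (b))
  have i6 := ((integrable_eAA hΓ hΓop Y hUd hU'c hκ₀ hκ₁ ha hτ hδ hθ1 hκθ hstab hU'b ψ m k).const_mul (b * d))
  have i7 := ((integrable_eAA hΓ hΓop Y hUd hU'c hκ₀ hκ₁ ha hτ hδ hθ1 hκθ hstab hU'b ψ m l).const_mul (b * c))
  have i8 := ((integrable_weighted_blockDeriv_apply hΓ hΓop Y hUd hU'c hκ₀ hκ₁ ha hτ hδ hθ1 hκθ hstab hU'b ψ m).const_mul (b * c * d))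
  have i9 := ((integrable_eAAA hΓ hΓop Y hUd hU'c hκ₀ hκ₁ ha hτ hδ hθ1 hκθ hstab hU'b ψ h k l).const_mul (a))
  have i10 := ((integrable_eAA hΓ hΓop Y hUd hU'c hκ₀ hκ₁ ha hτ hδ hθ1 hκθ hstab hU'b ψ h k).const_mul (a * d))
  have i11 := ((integrable_eAA hΓ hΓop Y hUd hU'c hκ₀ hκ₁ ha hτ hδ hθ1 hκθ hstab hU'b ψ h l).const_mul (a * c))
  have i12 := ((integrable_weighted_blockDeriv_apply hΓ hΓop Y hUd hU'c hκ₀ hκ₁ ha hτ hδ hθ1 hκθ hstab hU'b ψ h).const_mul (a * c * d))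
  have i13 := ((integrable_eAA hΓ hΓop Y hUd hU'c hκ₀ hκ₁ ha hτ hδ hθ1 hκθ hstab hU'b ψ k l).const_mul (a * b))
  have i14 := ((integrable_weighted_blockDeriv_apply hΓ hΓop Y hUd hU'c hκ₀ hκ₁ ha hτ hδ hθ1 hκθ hstab hU'b ψ k).const_mul (a * b * d))
  have i15 := ((integrable_weighted_blockDeriv_apply hΓ hΓop Y hUd hU'c hκ₀ hκ₁ ha hτ hδ hθ1 hκθ hstab hU'b ψ l).const_mul (a * b * c))
  have i16 := ((integrable_e hΓ hΓop Y hUd hκ₀ hκ₁ ha hτ hδ hθ1 hκθ hstab hU'b ψ).const_mul (a * b * c * d))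
  rw [integral_add ((((((((((((((i1.sub' i2).sub' i3).fun_add i4).sub' i5).fun_add i6).fun_add i7).sub' i8).sub' i9).fun_add i10).fun_add i11).sub'
      i12).fun_add i13).sub' i14).sub' i15) i16, integral_sub (((((((((((((i1.sub' i2).sub' i3).fun_add i4).sub' i5).fun_add i6).fun_add i7).sub'
      i8).sub' i9).fun_add i10).fun_add i11).sub' i12).fun_add i13).sub' i14) i15, integral_sub ((((((((((((i1.sub' i2).sub' i3).fun_add i4).sub'
      i5).fun_add i6).fun_add i7).sub' i8).sub' i9).fun_add i10).fun_add i11).sub' i12).fun_add i13) i14, integral_add (((((((((((i1.sub' i2).sub'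
      i3).fun_add i4).sub' i5).fun_add i6).fun_add i7).sub' i8).sub' i9).fun_add i10).fun_add i11).sub' i12) i13, integral_sub ((((((((((i1.sub'
      i2).sub' i3).fun_add i4).sub' i5).fun_add i6).fun_add i7).sub' i8).sub' i9).fun_add i10).fun_add i11) i12, integral_add (((((((((i1.sub'
      i2).sub' i3).fun_add i4).sub' i5).fun_add i6).fun_add i7).sub' i8).sub' i9).fun_add i10) i11, integral_add ((((((((i1.sub' i2).sub' i3).fun_add
      i4).sub' i5).fun_add i6).fun_add i7).sub' i8).sub' i9) i10, integral_sub (((((((i1.sub' i2).sub' i3).fun_add i4).sub' i5).fun_add i6).fun_add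
      i7).sub' i8) i9, integral_sub ((((((i1.sub' i2).sub' i3).fun_add i4).sub' i5).fun_add i6).fun_add i7) i8, integral_add (((((i1.sub' i2).sub'
      i3).fun_add i4).sub' i5).fun_add i6) i7, integral_add ((((i1.sub' i2).sub' i3).fun_add i4).sub' i5) i6, integral_sub (((i1.sub' i2).sub'
      i3).fun_add i4) i5, integral_add ((i1.sub' i2).sub' i3) i4, integral_sub (i1.sub' i2) i3, integral_sub i1 i2]
  simp only [integral_const_mul]

/-! ## §3. Toy -/

/-- Toy (§2's pointwise algebra): the centred pair expands into four monomials. -/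
example (x y a b : ℝ) : (x - a) * (y - b) = x * y - b * x - a * y + a * b := by ring

end Summit.QuantumFields.BalabanUV.T4Continuum.NE7b.SupFourthOrderSplitting

end
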